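import Summits.CriticalPhenomena.PercolationContinuityZ3.Theorems.PercNearOneGluingAdditiveGluingKillSetTransfer
import Summits.CriticalPhenomena.PercolationContinuityZ3.Theorems.PercNearOneGluingAdditiveGluingKnThm2GoodEvents
import HarnessLib

/-! # Crux `PercNearOneGluing.AdditiveGluing` (stmt-CriticalPhenomena-4576), stub `stub_goodStep` — peeling a BLOCK at one of its vertices:
# the layer geometry (STUB-PLAN Line A, H5 `blockGood_peel`, part 1)

Stub-plan prover; lands `--supports stmt-CriticalPhenomena-4576`; no definitions, no named facts.

Setting (seat k24's σ-decomposition `stub_sigmaLaw`/`stub_sigmaGeometry` with the singleton block `O = {x}`): `x ∈ S` a block vertex,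
`L_{S'} = {ω | ∀ y, y ∈ S' ↔ (y ∉ {x} ∧ ∃ o ∈ {x}, s(o,y) ∈ ω)}` the event "the open star of `x` is `S'`", and
`Ψ_{S'} ω = {e ∈ ω | e avoids x} ∪ D_{S'}` the configuration off `x` with the layer glued.  The CHILD block is
`T' = S.erase x ∪ S'`, the child weighting `u − x` is `fun e => if ∃ y ∈ {x}, y ∈ e then 0 else u e`.
* `peel_exists_conn_iff` etc.: on `L_{S'}`, the block events of `S` under `ω` are the block events of `T'` under `Ψ_{S'} ω`
  (`{a₀ ↔ b}`, `{a₀ ↔ S}`, `{S ↔ b}`, and the pockets: `{K_S = W} ↔ {K_{T'} = W.erase x}` for `x ∈ W`);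
* `peel_glue_glue`: gluing `T' ⊇ S'` after `S'` is gluing `T'` (as weightings), whence (`blockGrowth_glue_real_*`, H3) the law of
  the block events of `T'` is the same under `(u − x)/S'` (the law of `Ψ_{S'}`) and under `u − x`
  (`peel_real_lhs_eq`, `peel_real_reach_eq`, `peel_real_pocket_eq`);
* `peel_real_factor_eq`: the pocket factor does not see `x`: `μ_u(a ↔ b in Wᶜ) = μ_{u−x}(a ↔ b in (W.erase x)ᶜ)` (`x ∈ W`, `a ≠ x`);
  `peel_real_childPocket_eq_zero`: a child pocket containing `x` is null.
[folklore; Kozma–Nitzan arXiv:2401.12397 §3.2 (proof of Thms 4–5, pp. 13–14: decomposition by the open star)]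
-/

namespace Summit.CriticalPhenomena.PercolationContinuityZ3.Theorems

open MeasureTheory Set Filter
open Literature.Probability.LatticeModels (prodBernoulli)
open Literature.Probability.Percolation (BondConfig openConn openConnIn openGraph openCluster)
open scoped BigOperators

noncomputable section
open Classical

section BlockGoodPeelLayers

open Literature.Probability.LatticeModels Literature.Probability.Percolation

variable {n : ℕ}

/-- The clique condition of `stub_sigmaGeometry` is vacuous for a singleton block. [folklore] -/
theorem peel_clique (x : Fin n) (ω : BondConfig (Fin n)) :
    ∀ o₁ ∈ ({x} : Finset (Fin n)), ∀ o₂ ∈ ({x} : Finset (Fin n)), o₁ ≠ o₂ → s(o₁, o₂) ∈ ω := by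
  intro o₁ h₁ o₂ h₂ hne
  exact absurd ((Finset.mem_singleton.1 h₁).trans (Finset.mem_singleton.1 h₂).symm) hne

/-- In `Ψ_{S'} ω` no pair contains `x` (when `x ∉ S'`). [folklore] -/
theorem peel_psi_avoids (x : Fin n) (S' : Finset (Fin n)) (hxS' : x ∉ S') (ω : BondConfig (Fin n)) :
    ∀ e ∈ ({e | e ∈ ω ∧ ∀ y ∈ e, y ∉ ({x} : Finset (Fin n))} ∪ {e | (∀ y ∈ e, y ∈ S') ∧ ¬ e.IsDiag} :
      BondConfig (Fin n)), x ∉ e := by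
  rintro e (⟨-, he⟩ | ⟨he, -⟩) hxe
  · exact he x hxe (Finset.mem_singleton_self x)
  · exact hxS' (he x hxe)

/-- **Layer geometry, core**: on `L_{S'}`, for `c ≠ x`, `S ↔ c` in `ω` iff `T' ↔ c` in `Ψ_{S'} ω` (`T' = S.erase x ∪ S'`, `x ∈ S`).
[cite: KozmaNitzan2024, §3.2 (pp. 13–14)] -/
theorem peel_exists_conn_iff (S S' : Finset (Fin n)) (x c : Fin n) (hx : x ∈ S) (hcx : c ≠ x) (ω : BondConfig (Fin n))
    (hL : ∀ y : Fin n, y ∈ S' ↔ (y ∉ ({x} : Finset (Fin n)) ∧ ∃ o ∈ ({x} : Finset (Fin n)), s(o, y) ∈ ω)) :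
    (ω ∈ ⋃ s ∈ S, openConn s c) ↔
      (({e | e ∈ ω ∧ ∀ y ∈ e, y ∉ ({x} : Finset (Fin n))} ∪ {e | (∀ y ∈ e, y ∈ S') ∧ ¬ e.IsDiag} :
        BondConfig (Fin n)) ∈ ⋃ t ∈ S.erase x ∪ S', openConn t c) := by
  have hgeo := stub_sigmaGeometry n ({x} : Finset (Fin n)) S' ω hL (peel_clique x ω)
  have hcO : c ∉ ({x} : Finset (Fin n)) := fun h => hcx (Finset.mem_singleton.1 h)
  -- through `x`: `x ↔ c` iff `S' ↔ c` off `x`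
  have h1 := hgeo.1 {c} (Finset.disjoint_singleton_right.2 (fun h => hcx (Finset.mem_singleton.1 h)))
  simp only [Finset.set_biUnion_singleton] at h1
  -- `h1 : ω ∈ openConn x c ↔ ψ ∈ ⋃ s ∈ S', openConn s c`
  simp only [Set.mem_iUnion, exists_prop, Finset.mem_union, Finset.mem_erase]
  constructor
  · rintro ⟨s, hs, hsc⟩
    by_cases hsx : s = x
    · subst hsx
      obtain ⟨t, ht, htc⟩ := Set.mem_iUnion₂.1 (h1.1 hsc)
      exact ⟨t, Or.inr ht, htc⟩
    · have hsO : s ∉ ({x} : Finset (Fin n)) := fun h => hsx (Finset.mem_singleton.1 h)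
      exact ⟨s, Or.inl ⟨hsx, hs⟩, (hgeo.2 s c hsO hcO).1 hsc⟩
  · rintro ⟨t, ht | ht, htc⟩
    · exact ⟨t, ht.2, (hgeo.2 t c (fun h => ht.1 (Finset.mem_singleton.1 h)) hcO).2 htc⟩
    · exact ⟨x, hx, h1.2 (Set.mem_iUnion₂.2 ⟨t, ht, htc⟩)⟩

/-- On `L_{S'}`: `a₀ ↔ S` in `ω` iff `a₀ ↔ T'` in `Ψ_{S'} ω` (`a₀ ≠ x`). [cite: KozmaNitzan2024, §3.2 (pp. 13–14)] -/
theorem peel_conn_exists_iff (S S' : Finset (Fin n)) (x a₀ : Fin n) (hx : x ∈ S) (hax : a₀ ≠ x) (ω : BondConfig (Fin n))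
    (hL : ∀ y : Fin n, y ∈ S' ↔ (y ∉ ({x} : Finset (Fin n)) ∧ ∃ o ∈ ({x} : Finset (Fin n)), s(o, y) ∈ ω)) :
    (ω ∈ ⋃ s ∈ S, openConn a₀ s) ↔
      (({e | e ∈ ω ∧ ∀ y ∈ e, y ∉ ({x} : Finset (Fin n))} ∪ {e | (∀ y ∈ e, y ∈ S') ∧ ¬ e.IsDiag} :
        BondConfig (Fin n)) ∈ ⋃ t ∈ S.erase x ∪ S', openConn a₀ t) := by
  have h := peel_exists_conn_iff S S' x a₀ hx hax ω hL
  simp only [knThm2_openConn_comm _ a₀] at h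
  exact h

/-- On `L_{S'}`: `a₀ ↔ b` in `ω` iff in `Ψ_{S'} ω` (`a₀, b ≠ x`). [cite: KozmaNitzan2024, §3.2 (pp. 13–14)] -/
theorem peel_openConn_iff (S' : Finset (Fin n)) (x a₀ b : Fin n) (hax : a₀ ≠ x) (hbx : b ≠ x) (ω : BondConfig (Fin n))
    (hL : ∀ y : Fin n, y ∈ S' ↔ (y ∉ ({x} : Finset (Fin n)) ∧ ∃ o ∈ ({x} : Finset (Fin n)), s(o, y) ∈ ω)) :
    ω ∈ openConn a₀ b ↔
      (({e | e ∈ ω ∧ ∀ y ∈ e, y ∉ ({x} : Finset (Fin n))} ∪ {e | (∀ y ∈ e, y ∈ S') ∧ ¬ e.IsDiag} :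
        BondConfig (Fin n)) ∈ openConn a₀ b) :=
  (stub_sigmaGeometry n ({x} : Finset (Fin n)) S' ω hL (peel_clique x ω)).2 a₀ b
    (fun h => hax (Finset.mem_singleton.1 h)) (fun h => hbx (Finset.mem_singleton.1 h))

/-- On `L_{S'}` with `x ∉ S'`: for `x ∈ W`, `{K_S = W}` at `ω` iff `{K_{T'} = W.erase x}` at `Ψ_{S'} ω`.
[cite: KozmaNitzan2024, §3.2 (pp. 13–14)] -/
theorem peel_pocket_iff (S S' W : Finset (Fin n)) (x : Fin n) (hx : x ∈ S) (hxS' : x ∉ S') (hxW : x ∈ W)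
    (ω : BondConfig (Fin n))
    (hL : ∀ y : Fin n, y ∈ S' ↔ (y ∉ ({x} : Finset (Fin n)) ∧ ∃ o ∈ ({x} : Finset (Fin n)), s(o, y) ∈ ω)) :
    (∀ z : Fin n, (z ∈ W ↔ ω ∈ ⋃ s ∈ S, openConn s z)) ↔
      (∀ z : Fin n, (z ∈ W.erase x ↔
        (({e | e ∈ ω ∧ ∀ y ∈ e, y ∉ ({x} : Finset (Fin n))} ∪ {e | (∀ y ∈ e, y ∈ S') ∧ ¬ e.IsDiag} :
          BondConfig (Fin n)) ∈ ⋃ t ∈ S.erase x ∪ S', openConn t z))) := by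
  set ψ : BondConfig (Fin n) := ({e | e ∈ ω ∧ ∀ y ∈ e, y ∉ ({x} : Finset (Fin n))} ∪
    {e | (∀ y ∈ e, y ∈ S') ∧ ¬ e.IsDiag} : BondConfig (Fin n)) with hψ
  -- the vertex `x` itself: always in `K_S`, never reached in `Ψ_{S'} ω`
  have hxS : ω ∈ ⋃ s ∈ S, openConn s x :=
    Set.mem_iUnion₂.2 ⟨x, hx, (SimpleGraph.Reachable.refl x : (openGraph ω).Reachable x x)⟩
  have hxT : ψ ∉ ⋃ t ∈ S.erase x ∪ S', openConn t x := by
    intro h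
    obtain ⟨t, ht, htx⟩ := Set.mem_iUnion₂.1 h
    have htne : x ≠ t := by
      rintro rfl
      rcases Finset.mem_union.1 ht with ht | ht
      · exact (Finset.mem_erase.1 ht).1 rfl
      · exact hxS' ht
    obtain ⟨z, -, hz, -⟩ := goodBase_exists_open_pair (SimpleGraph.Reachable.symm htx) htne.symm
    exact peel_psi_avoids x S' hxS' ω _ hz (Sym2.mem_mk_left x z)
  refine ⟨fun h z => ?_, fun h z => ?_⟩
  · by_cases hzx : z = x
    · subst hzx
      simp only [Finset.mem_erase, ne_eq, not_true_eq_false, false_and, false_iff]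
      exact hxT
    · rw [Finset.mem_erase, ← peel_exists_conn_iff S S' x z hx hzx ω hL, ← h z]
      exact ⟨fun h' => h'.2, fun h' => ⟨hzx, h'⟩⟩
  · by_cases hzx : z = x
    · subst hzx
      exact ⟨fun _ => hxS, fun _ => hxW⟩
    · rw [peel_exists_conn_iff S S' x z hx hzx ω hL, ← h z, Finset.mem_erase]
      exact ⟨fun h' => ⟨hzx, h'⟩, fun h' => h'.2⟩

/-- **Gluing `T' ⊇ S'` after `S'` is gluing `T'`**, for the child weighting of the layer (`x ∉ T'`): as weightings,
`(u − x)/S' /T' = (u − x)/T'`. [folklore] -/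
theorem peel_glue_glue (u : Sym2 (Fin n) → unitInterval) (S' T' : Finset (Fin n)) (x : Fin n) (hST : S' ⊆ T') :
    (fun e : Sym2 (Fin n) => if (∀ y ∈ e, y ∈ T') ∧ ¬ e.IsDiag then (1 : unitInterval) else
      (fun e : Sym2 (Fin n) => if (∀ y ∈ e, y ∈ S') ∧ ¬ e.IsDiag then (1 : unitInterval) else
        if (∃ y ∈ e, y ∈ ({x} : Finset (Fin n))) then 0 else u e) e) =
    (fun e : Sym2 (Fin n) => if (∀ y ∈ e, y ∈ T') ∧ ¬ e.IsDiag then (1 : unitInterval) else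
      (fun e : Sym2 (Fin n) => if ∃ y ∈ ({x} : Finset (Fin n)), y ∈ e then (0 : unitInterval) else u e) e) := by
  funext e
  by_cases hT : (∀ y ∈ e, y ∈ T') ∧ ¬ e.IsDiag
  · simp only [if_pos hT]
  · simp only [if_neg hT]
    have hS : ¬ ((∀ y ∈ e, y ∈ S') ∧ ¬ e.IsDiag) := fun h => hT ⟨fun y hy => hST (h.1 y hy), h.2⟩
    rw [if_neg hS]
    by_cases hx : ∃ y ∈ e, y ∈ ({x} : Finset (Fin n))
    · obtain ⟨y, hy, hyx⟩ := hx
      rw [if_pos ⟨y, hy, hyx⟩, if_pos ⟨y, hyx, hy⟩]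
    · rw [if_neg hx, if_neg]
      rintro ⟨y, hyx, hy⟩
      exact hx ⟨y, hy, hyx⟩

/-- The law of the child's block two-point data under `(u−x)/S'` equals that under `u − x` — LEFT side of BG:
`μ(a₀↔b) + μ(a₀↮b, a₀↔T', T'↔b)`. [cite: KozmaNitzan2024, §3.1 (gluing), §3.2] -/
theorem peel_real_lhs_eq (u : Sym2 (Fin n) → unitInterval) (S' T' : Finset (Fin n)) (x a₀ b : Fin n) (hST : S' ⊆ T') :
    (prodBernoulli (fun e : Sym2 (Fin n) => if (∀ y ∈ e, y ∈ S') ∧ ¬ e.IsDiag then (1 : unitInterval) else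
        if (∃ y ∈ e, y ∈ ({x} : Finset (Fin n))) then 0 else u e)).real (openConn a₀ b)
      + (prodBernoulli (fun e : Sym2 (Fin n) => if (∀ y ∈ e, y ∈ S') ∧ ¬ e.IsDiag then (1 : unitInterval) else
        if (∃ y ∈ e, y ∈ ({x} : Finset (Fin n))) then 0 else u e)).real
          ((openConn a₀ b)ᶜ ∩ (⋃ t ∈ T', openConn a₀ t) ∩ (⋃ t ∈ T', openConn t b)) =
    (prodBernoulli (fun e : Sym2 (Fin n) => if ∃ y ∈ ({x} : Finset (Fin n)), y ∈ e then (0 : unitInterval) else u e)).real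
        (openConn a₀ b)
      + (prodBernoulli (fun e : Sym2 (Fin n) => if ∃ y ∈ ({x} : Finset (Fin n)), y ∈ e then (0 : unitInterval) else u e)).real
          ((openConn a₀ b)ᶜ ∩ (⋃ t ∈ T', openConn a₀ t) ∩ (⋃ t ∈ T', openConn t b)) := by
  have e1 := blockGrowth_glue_real_openConn
    (fun e : Sym2 (Fin n) => if (∀ y ∈ e, y ∈ S') ∧ ¬ e.IsDiag then (1 : unitInterval) else
        if (∃ y ∈ e, y ∈ ({x} : Finset (Fin n))) then 0 else u e) T' a₀ b
  have e2 := blockGrowth_glue_real_openConn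
    (fun e : Sym2 (Fin n) => if ∃ y ∈ ({x} : Finset (Fin n)), y ∈ e then (0 : unitInterval) else u e) T' a₀ b
  rw [← e1, ← e2, peel_glue_glue u S' T' x hST]

/-- The same for the block's reach `μ(T' ↔ b)`. [cite: KozmaNitzan2024, §3.1 (gluing), §3.2] -/
theorem peel_real_reach_eq (u : Sym2 (Fin n) → unitInterval) (S' T' : Finset (Fin n)) (x b : Fin n) (hST : S' ⊆ T') :
    (prodBernoulli (fun e : Sym2 (Fin n) => if (∀ y ∈ e, y ∈ S') ∧ ¬ e.IsDiag then (1 : unitInterval) else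
        if (∃ y ∈ e, y ∈ ({x} : Finset (Fin n))) then 0 else u e)).real (⋃ t ∈ T', openConn t b) =
    (prodBernoulli (fun e : Sym2 (Fin n) => if ∃ y ∈ ({x} : Finset (Fin n)), y ∈ e then (0 : unitInterval) else u e)).real
        (⋃ t ∈ T', openConn t b) := by
  have e1 := blockGrowth_glue_real_iUnion
    (fun e : Sym2 (Fin n) => if (∀ y ∈ e, y ∈ S') ∧ ¬ e.IsDiag then (1 : unitInterval) else
        if (∃ y ∈ e, y ∈ ({x} : Finset (Fin n))) then 0 else u e) T' b
  have e2 := blockGrowth_glue_real_iUnion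
    (fun e : Sym2 (Fin n) => if ∃ y ∈ ({x} : Finset (Fin n)), y ∈ e then (0 : unitInterval) else u e) T' b
  rw [← e1, ← e2, peel_glue_glue u S' T' x hST]

/-- The same for the block pockets `μ(K_{T'} = W')`. [cite: KozmaNitzan2024, §3.1 (gluing), §3.2] -/
theorem peel_real_pocket_eq (u : Sym2 (Fin n) → unitInterval) (S' T' W' : Finset (Fin n)) (x : Fin n) (hST : S' ⊆ T') :
    (prodBernoulli (fun e : Sym2 (Fin n) => if (∀ y ∈ e, y ∈ S') ∧ ¬ e.IsDiag then (1 : unitInterval) else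
        if (∃ y ∈ e, y ∈ ({x} : Finset (Fin n))) then 0 else u e)).real
        {ω : BondConfig (Fin n) | ∀ z : Fin n, (z ∈ W' ↔ ω ∈ ⋃ t ∈ T', openConn t z)} =
    (prodBernoulli (fun e : Sym2 (Fin n) => if ∃ y ∈ ({x} : Finset (Fin n)), y ∈ e then (0 : unitInterval) else u e)).real
        {ω : BondConfig (Fin n) | ∀ z : Fin n, (z ∈ W' ↔ ω ∈ ⋃ t ∈ T', openConn t z)} := by
  have e1 := blockGrowth_glue_real_pocket
    (fun e : Sym2 (Fin n) => if (∀ y ∈ e, y ∈ S') ∧ ¬ e.IsDiag then (1 : unitInterval) else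
        if (∃ y ∈ e, y ∈ ({x} : Finset (Fin n))) then 0 else u e) T' W'
  have e2 := blockGrowth_glue_real_pocket
    (fun e : Sym2 (Fin n) => if ∃ y ∈ ({x} : Finset (Fin n)), y ∈ e then (0 : unitInterval) else u e) T' W'
  rw [← e1, ← e2, peel_glue_glue u S' T' x hST]

/-- **The pocket factor does not see `x`**: for `x ∈ W` and `a ≠ x`, `μ_u(a ↔ b in Wᶜ) = μ_{u−x}(a ↔ b in (W.erase x)ᶜ)`. [folklore] -/
theorem peel_real_factor_eq (u : Sym2 (Fin n) → unitInterval) (W : Finset (Fin n)) (x a b : Fin n) (hxW : x ∈ W)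
    (hax : a ≠ x) :
    (prodBernoulli u).real (openConnIn ((W : Set (Fin n))ᶜ) a b) =
      (prodBernoulli (fun e : Sym2 (Fin n) => if ∃ y ∈ ({x} : Finset (Fin n)), y ∈ e then (0 : unitInterval) else u e)).real
        (openConnIn ((↑(W.erase x) : Set (Fin n))ᶜ) a b) := by
  have haO : a ∉ ({x} : Finset (Fin n)) := fun h => hax (Finset.mem_singleton.1 h)
  rw [killSet_real_openConnIn_eq u {x} (W.erase x) a b haO]
  have hW : ({x} : Finset (Fin n)) ∪ W.erase x = W := by
    rw [← Finset.insert_eq, Finset.insert_erase hxW]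
  rw [hW]
  refine (killSet_real_eq_of_determinedBy u {x} _ ((offObs_determinedBy_openConnIn_compl W a b).mono ?_)).symm
  intro e he
  simp only [Finset.coe_filter, Finset.mem_univ, true_and, Set.mem_setOf_eq, Finset.mem_singleton] at he ⊢
  rintro v hv rfl
  exact he v hv hxW

/-- A child pocket containing `x` is null: under `u − x` the vertex `x ∉ T'` is isolated. [folklore] -/
theorem peel_real_childPocket_eq_zero (u : Sym2 (Fin n) → unitInterval) (T' W' : Finset (Fin n)) (x : Fin n)
    (hxT : x ∉ T') (hxW' : x ∈ W') :
    (prodBernoulli (fun e : Sym2 (Fin n) => if ∃ y ∈ ({x} : Finset (Fin n)), y ∈ e then (0 : unitInterval) else u e)).real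
        {ω : BondConfig (Fin n) | ∀ z : Fin n, (z ∈ W' ↔ ω ∈ ⋃ t ∈ T', openConn t z)} = 0 := by
  refine le_antisymm ?_ measureReal_nonneg
  have h0 : ∀ t ∈ T', (prodBernoulli (fun e : Sym2 (Fin n) =>
      if ∃ y ∈ ({x} : Finset (Fin n)), y ∈ e then (0 : unitInterval) else u e)).real (openConn t x) = 0 := by
    intro t ht
    have htO : t ∉ ({x} : Finset (Fin n)) := fun h => hxT (Finset.mem_singleton.1 h ▸ ht)
    rw [killSet_real_openConn_eq_offConn u {x} t x htO]
    have : (openConnIn (((({x} : Finset (Fin n)) : Set (Fin n)))ᶜ) t x : Set (BondConfig (Fin n))) = ∅ :=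
      Set.eq_empty_of_forall_notMem fun ω hω => hω.2.1 (by simp)
    rw [this, measureReal_empty]
  calc (prodBernoulli (fun e : Sym2 (Fin n) => if ∃ y ∈ ({x} : Finset (Fin n)), y ∈ e then (0 : unitInterval) else u e)).real
        {ω : BondConfig (Fin n) | ∀ z : Fin n, (z ∈ W' ↔ ω ∈ ⋃ t ∈ T', openConn t z)}
      ≤ (prodBernoulli (fun e : Sym2 (Fin n) => if ∃ y ∈ ({x} : Finset (Fin n)), y ∈ e then (0 : unitInterval) else u e)).real
          (⋃ t ∈ T', openConn t x) :=
        measureReal_mono (fun ω hω => (hω x).1 hxW') (measure_ne_top _ _)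
    _ ≤ ∑ t ∈ T', (prodBernoulli (fun e : Sym2 (Fin n) =>
          if ∃ y ∈ ({x} : Finset (Fin n)), y ∈ e then (0 : unitInterval) else u e)).real (openConn t x) :=
        measureReal_biUnion_finset_le T' _
    _ = 0 := Finset.sum_eq_zero h0

end BlockGoodPeelLayers

open Literature.Probability.LatticeModels Literature.Probability.Percolation in
/-- Registered helper stub `stub_peelFactor_sp` (stub-plan prover; Line A H5 part 1): the pocket factor does not see the peeled
vertex, `μ_u(a ↔ b in Wᶜ) = μ_{u−x}(a ↔ b in (W.erase x)ᶜ)` for `x ∈ W`, `a ≠ x` (= `peel_real_factor_eq`). [folklore] -/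
theorem stub_peelFactor_sp : ∀ (n : ℕ) (u : Sym2 (Fin n) → unitInterval) (W : Finset (Fin n)) (x a b : Fin n), x ∈ W → a ≠ x → (prodBernoulli u).real (openConnIn ((W : Set (Fin n))ᶜ) a b) = (prodBernoulli (fun e : Sym2 (Fin n) => if ∃ y ∈ ({x} : Finset (Fin n)), y ∈ e then (0 : unitInterval) else u e)).real (openConnIn ((↑(W.erase x) : Set (Fin n))ᶜ) a b) :=
  fun _ u W x a b hxW hax => peel_real_factor_eq u W x a b hxW hax

end

end Summit.CriticalPhenomena.PercolationContinuityZ3.Theorems
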